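import Mathlib
import HarnessLib
import Summits.AtomisticToContinuum.Crystallization.Theorems.PricedLinkCensusSoftLayerPropagationStubBallPropagationLayersDown
import Summits.AtomisticToContinuum.Crystallization.Theorems.PricedLinkCensusSoftLayerPropagationStubBallPropagationStacking
import Summits.AtomisticToContinuum.Crystallization.Theorems.PricedLinkCensusSoftLayerPropagationStubBallPropagationDiscs
import Summits.AtomisticToContinuum.Crystallization.Theorems.PricedLinkCensusSoftLayerPropagationStubBallPropagationFrames
import Summits.AtomisticToContinuum.Crystallization.Theorems.PricedLinkCensusSoftLayerPropagationStubBallPropagationAssembly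
import Summits.AtomisticToContinuum.Crystallization.Theorems.PricedLinkCensusSoftLayerPropagationStubBallPropagationSchedules

/-!
# The finite-ball form of Hales, *Dense Sphere Packings* §1.3 — Case A: an HCP centre near the centre

Route `PricedLinkCensus`, crux `SoftLayerPropagation` (stmt-AtomisticToContinuum-14233), line
`Sketch`, towards the stub `stub_ballPropagation`.  CASE A of the proof: some centre `q` within
`15/2` of `u` has an HCP shell, and `q` is (almost) nearest among such (`dist u q² − 1/3 ≤ dist u v²`).
Frame at `q` (`…Frames.lean`, moved centre above the base plane), HCP base disc of radius `10.6`
(`hcp_disc`), nine layers up and five down with the radii of the table below (`layers_up`,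
`layers_down`, radius hypotheses by `ring_hyp_of`, `par_hyp_of`, the far corner always available),
splice (`exists_haggSeq_of_signs`, `barlowPos_mem_of_layers`), and no room
(`exists_isometry_inter_closedBall_eq_of_frame_sharp`): `V ∩ closedBall u 7` is a moved Barlow
stacking cut to the ball.
-/

noncomputable section

namespace Summit.AtomisticToContinuum.Crystallization.Theorems

open Literature.Geometry.DiscreteGeometry Literature.MathematicalPhysics.StatisticalMechanics
open RealInnerProductSpace

/-! ### Small transport lemmas -/

/-- Arrangement in a pattern passes to the image under a linear isometry equivalence. [folklore] -/
theorem IsArrangedIn.image_equiv {T : Set (EuclideanSpace ℝ (Fin 3))} {P : Finset (EuclideanSpace ℝ (Fin 3))}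
    (h : IsArrangedIn T P) (L : EuclideanSpace ℝ (Fin 3) ≃ₗᵢ[ℝ] EuclideanSpace ℝ (Fin 3)) :
    IsArrangedIn (L '' T) P := by
  obtain ⟨A, rfl⟩ := h
  refine ⟨L.toLinearIsometry.comp A, ?_⟩
  ext x
  simp only [Set.mem_image, Finset.mem_coe, LinearIsometry.coe_comp, Function.comp_apply,
    LinearIsometryEquiv.coe_toLinearIsometry]
  constructor
  · rintro ⟨_, ⟨p, hp, rfl⟩, rfl⟩
    exact ⟨p, hp, by rw [map_smul]⟩
  · rintro ⟨p, hp, rfl⟩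
    exact ⟨_, ⟨p, hp, rfl⟩, by rw [map_smul]⟩

/-- In the frame at `q`, the shell of `q + L η` in `V` is the image under `L` of the shell of `η`
in the moved packing. [folklore] -/
theorem kissingShell_eq_image_of_frame {V : Set (EuclideanSpace ℝ (Fin 3))} (q : EuclideanSpace ℝ (Fin 3))
    (L : EuclideanSpace ℝ (Fin 3) ≃ₗᵢ[ℝ] EuclideanSpace ℝ (Fin 3)) (η : EuclideanSpace ℝ (Fin 3)) :
    kissingShell V (q + L η) = L '' kissingShell {x | q + L x ∈ V} η := by
  rw [kissingShell_preimage, Set.image_preimage_eq _ L.surjective]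

/-- Distances in the frame at `q`. [folklore] -/
theorem dist_frame_eq {q u : EuclideanSpace ℝ (Fin 3)}
    (L : EuclideanSpace ℝ (Fin 3) ≃ₗᵢ[ℝ] EuclideanSpace ℝ (Fin 3)) (x : EuclideanSpace ℝ (Fin 3)) :
    dist x (L.symm (u - q)) = dist u (q + L x) := by
  rw [← L.dist_map, LinearIsometryEquiv.apply_symm_apply, dist_comm, ← dist_add_left q, add_sub_cancel]

/-- **A frame at an HCP centre with the moved centre above the base plane** (compose with the
reflection in the base plane if necessary). [folklore] -/
theorem exists_frame_of_hcp_centre_nonneg {V : Set (EuclideanSpace ℝ (Fin 3))} (hV : IsUnitBallPacking V)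
    {q : EuclideanSpace ℝ (Fin 3)} (u : EuclideanSpace ℝ (Fin 3))
    (harr : IsArrangedIn (kissingShell V q) hcpKissingPattern) :
    ∃ L : EuclideanSpace ℝ (Fin 3) ≃ₗᵢ[ℝ] EuclideanSpace ℝ (Fin 3), ∃ s : ℝ, (s = 1 ∨ s = -1) ∧
      kissingShell {x | q + L x ∈ V} 0 = layerShell s s ∧ 0 ≤ (L.symm (u - q)) 2 := by
  obtain ⟨L, s, hs, hshell⟩ := exists_frame_of_hcp_centre hV harr
  by_cases h : 0 ≤ (L.symm (u - q)) 2
  · exact ⟨L, s, hs, hshell, h⟩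
  · set Rf := ((ℝ ∙ (layerNormal layerSpacing : EuclideanSpace ℝ (Fin 3)))ᗮ).reflection with hRf
    refine ⟨Rf.trans L, s, hs, ?_, ?_⟩
    · have e : {x | q + (Rf.trans L) x ∈ V} = {x | Rf x ∈ {x | q + L x ∈ V}} := by
        ext x; simp [LinearIsometryEquiv.trans_apply]
      rw [e, kissingShell_reflected, map_zero, hshell, preimage_baseReflection_layerShell]
    · have e : (Rf.trans L).symm (u - q) = Rf (L.symm (u - q)) := by
        apply (Rf.trans L).injective
        rw [LinearIsometryEquiv.apply_symm_apply, LinearIsometryEquiv.trans_apply, hRf,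
          baseReflection_baseReflection, LinearIsometryEquiv.apply_symm_apply]
      rw [e, baseReflection_apply_two]
      linarith

/-! ### Case A -/

/-- **Case A of the finite-ball statement.**  If a centre `q` within `15/2` of `u` has an HCP shell
and is almost nearest among such centres (`dist u q² − 1/3 ≤ dist u v²`), then `V ∩ closedBall u 7`
is a moved close-packed Barlow stacking cut to the ball. [cite: HalesDSP2012, §1.3] -/
theorem caseA {V : Set (EuclideanSpace ℝ (Fin 3))} (hV : IsUnitBallPacking V) {u q : EuclideanSpace ℝ (Fin 3)}
    (hq : q ∈ V)
    (hpat : ∀ v ∈ V, dist u v ≤ 13 →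
      IsArrangedIn (kissingShell V v) fccKissingPattern ∨ IsArrangedIn (kissingShell V v) hcpKissingPattern)
    (hdq : dist u q ≤ 15 / 2) (harr : IsArrangedIn (kissingShell V q) hcpKissingPattern)
    (hmin : ∀ v ∈ V, dist u v ≤ 15 / 2 → IsArrangedIn (kissingShell V v) hcpKissingPattern →
      dist u q ^ 2 - 1 / 3 ≤ dist u v ^ 2) :
    ∃ s : ℤ → ℤ, IsHaggSeq s ∧
      ∃ g : EuclideanSpace ℝ (Fin 3) ≃ᵢ EuclideanSpace ℝ (Fin 3),
        V ∩ Metric.closedBall u 7 =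
          g '' barlowStacking 2 (2 * Real.sqrt (2 / 3)) s ∩ Metric.closedBall u 7 := by
  -- the frame
  obtain ⟨L, s₀, hs₀, hshell0, hnonneg⟩ := exists_frame_of_hcp_centre_nonneg hV u harr
  set V' : Set (EuclideanSpace ℝ (Fin 3)) := {x | q + L x ∈ V} with hV'def
  set u' : EuclideanSpace ℝ (Fin 3) := L.symm (u - q) with hu'def
  have hV' : IsUnitBallPacking V' := hV.preimage q L
  have h0V : (0 : EuclideanSpace ℝ (Fin 3)) ∈ V' := by simp [hV'def, hq]
  have hpat' := isArrangedIn_preimage_of_ball hpat q L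
  have hdu' : dist (0 : EuclideanSpace ℝ (Fin 3)) u' = dist u q := dist_zero_symm_sub_eq L
  have hnorm_u' : ‖u'‖ = dist u q := by rw [← hdu', dist_comm, dist_zero_right]
  have hnu' : ‖u'‖ ≤ 15 / 2 := by rw [hnorm_u']; exact hdq
  -- the height `a` (in units of `𝗁`) and the foot `c` of the axis
  set a : ℝ := u' 2 / layerSpacing with ha
  set c : EuclideanSpace ℝ (Fin 3) := u' - a • layerNormal layerSpacing with hcdef
  have hh := layerSpacing_pos
  obtain ⟨hh1, hh2⟩ := layerSpacing_bounds
  have hc2 : c 2 = 0 := by simp [hcdef, ha, hh.ne']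
  have hu'c : u' = c + a • layerNormal layerSpacing := by rw [hcdef]; abel
  have ha0 : 0 ≤ a := div_nonneg hnonneg hh.le
  have hau : a * layerSpacing = u' 2 := by rw [ha]; field_simp
  have ha1 : a ≤ 4.5931 := by
    have h1 : (u' 2) ^ 2 ≤ ‖u'‖ ^ 2 := sq_apply_two_le_norm_sq u'
    have h2 : ‖u'‖ ^ 2 ≤ (15 / 2) ^ 2 := pow_le_pow_left₀ (norm_nonneg _) hnu' 2
    have h3 : (a * layerSpacing) ^ 2 ≤ (15 / 2) ^ 2 := by rw [hau]; linarith
    have h4 : a * layerSpacing ≤ 15 / 2 :=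
      (pow_le_pow_iff_left₀ (by positivity) (by norm_num) two_ne_zero).1 h3
    have h5 : a * 1.6329 ≤ a * layerSpacing := mul_le_mul_of_nonneg_left hh1.le ha0
    linarith
  have hcu : ‖c‖ ^ 2 + 8 / 3 * a ^ 2 = ‖u'‖ ^ 2 := by
    conv_rhs => rw [hu'c]
    rw [norm_sq_add_smul_frameE hc2]
  -- patterns in the cylinder: a point `y` with horizontal foot within `P` and height `t𝗁`
  have good_of : ∀ (y : EuclideanSpace ℝ (Fin 3)) (t P : ℝ), y 2 = t * layerSpacing →
      ‖y - (c + t • layerNormal layerSpacing)‖ ≤ P → 0 ≤ P →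
      P ^ 2 + 8 / 3 * (t - a) ^ 2 ≤ 169 → dist y u' ≤ 13 := by
    intro y t P hy hP hP0 hle
    have hor : (y - (c + t • layerNormal layerSpacing)) 2 = 0 := by simp [hy, hc2]
    have e : y - u' = (y - (c + t • layerNormal layerSpacing)) + (t - a) • layerNormal layerSpacing := by
      rw [hu'c]; module
    have h1 : dist y u' ^ 2 ≤ 169 := by
      rw [dist_eq_norm, e, norm_sq_add_smul_frameE hor]
      nlinarith [norm_nonneg (y - (c + t • layerNormal layerSpacing))]
    nlinarith [dist_nonneg (x := y) (y := u')]
  -- the foot is within `√2` of the origin (the almost-nearest HCP centre)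
  have hc_small : ‖((0 : ℤ) : ℝ) • (triangularVec₁ 2 : EuclideanSpace ℝ (Fin 3)) +
      ((0 : ℤ) : ℝ) • triangularVec₂ 2 - c‖ ^ 2 ≤ 2 := by
    have hkey : ∀ η ∈ hexagonSet, ‖u'‖ ^ 2 - 1 / 3 ≤ ‖η - u'‖ ^ 2 := by
      intro η hη
      have hη2 : ‖η‖ = 2 := norm_of_mem_hexagonSet hη
      -- the equatorial neighbour `q + L η` is an HCP centre
      have hpatη : IsArrangedIn (kissingShell V' η) fccKissingPattern ∨
          IsArrangedIn (kissingShell V' η) hcpKissingPattern := by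
        have hηV : η ∈ V' := by
          have : η ∈ kissingShell V' 0 := by rw [hshell0]; exact hexagonSet_subset_layerShell _ _ hη
          simpa [kissingShell] using this.1
        refine hpat' η hηV ?_
        calc dist η u' ≤ ‖η‖ + ‖u'‖ := by rw [dist_eq_norm]; exact norm_sub_le _ _
          _ ≤ 13 := by rw [hη2]; linarith
      obtain ⟨hηV, hηshell⟩ := kissingShell_add_eq_layerShell_of_hcp_dir hV' hs₀ h0V hshell0 hη
        (by simpa using hpatη)
      rw [zero_add] at hηV hηshell
      have harrη : IsArrangedIn (kissingShell V (q + L η)) hcpKissingPattern := by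
        rw [kissingShell_eq_image_of_frame, hηshell]
        exact IsArrangedIn.image_equiv (isArrangedIn_layerShell_hcp' hs₀) L
      have hd : dist η u' = dist u (q + L η) := dist_frame_eq L η
      have hηu : dist η u' ^ 2 = ‖η - u'‖ ^ 2 := by rw [dist_eq_norm]
      have hu0 : ‖u'‖ = dist u q := hnorm_u'
      rcases le_or_gt (dist u (q + L η)) (15 / 2) with hle | hlt
      · have := hmin (q + L η) hηV hle harrη
        rw [← hd, hηu, ← hu0] at this
        exact this
      · have h1 : ‖u'‖ ≤ dist η u' := by rw [hd, hu0]; linarith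
        have h2 : ‖u'‖ ^ 2 ≤ ‖η - u'‖ ^ 2 := by
          rw [← hηu]; exact pow_le_pow_left₀ (norm_nonneg _) h1 2
        linarith
    have h1 := sq_add_sq_le_two_of_forall_hexagon hkey
    have e : ((0 : ℤ) : ℝ) • (triangularVec₁ 2 : EuclideanSpace ℝ (Fin 3)) +
        ((0 : ℤ) : ℝ) • triangularVec₂ 2 - c = -c := by simp
    rw [e, norm_neg, norm_sq_fin3, hc2]
    have hc0 : c 0 = u' 0 := by simp [hcdef]
    have hc1 : c 1 = u' 1 := by simp [hcdef]
    rw [hc0, hc1]; linarith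
  -- the base disc of radius `10.6`
  have hbase : ∀ i j : ℤ,
      ‖((i : ℝ) • (triangularVec₁ 2 : EuclideanSpace ℝ (Fin 3)) + (j : ℝ) • triangularVec₂ 2) - c‖ ≤ 10.6 →
      (i : ℝ) • (triangularVec₁ 2 : EuclideanSpace ℝ (Fin 3)) + (j : ℝ) • triangularVec₂ 2 ∈ V' ∧
      kissingShell V' ((i : ℝ) • (triangularVec₁ 2 : EuclideanSpace ℝ (Fin 3)) + (j : ℝ) • triangularVec₂ 2)
        = layerShell s₀ s₀ := by
    refine hcp_disc hV' hs₀ hc2 (R := 10.6) (fun i j hij hmem => hpat' _ hmem ?_) (i₀ := 0) (j₀ := 0)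
      hc_small (by simpa using h0V) (by simpa using hshell0)
    refine good_of _ 0 10.6 (by simp) (by simpa using hij) (by norm_num) ?_
    nlinarith
  -- the schedules
  obtain ⟨Pu, Ru, hPu0, hPu2, hRu, hparu, hfaru, hgoodu, hcovu⟩ := exists_up_schedule'
  obtain ⟨Pd, Rd, hPd0, hPd2, hRd, hpard, hfard, hgoodd, hcovd⟩ := exists_down_schedule'
  set Nu : ℕ := ⌊a + 5.2443⌋₊ with hNu
  set Nd : ℕ := ⌊5.2443 - a⌋₊ with hNd
  have hNu9 : Nu ≤ 9 := by
    have : Nu < 10 := (Nat.floor_lt (by linarith)).2 (by push_cast; linarith)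
    omega
  have hNd5 : Nd ≤ 5 := by
    have : Nd < 6 := (Nat.floor_lt (by linarith)).2 (by push_cast; linarith)
    omega
  have hNu_le : ∀ n < Nu, (n : ℝ) + 1 ≤ a + 5.2443 := fun n hn => by
    have : n + 1 ≤ Nu := hn
    rw [hNu, Nat.le_floor_iff (by linarith)] at this
    exact_mod_cast this
  have hNd_le : ∀ n < Nd, (n : ℝ) + 1 ≤ 5.2443 - a := fun n hn => by
    have : n + 1 ≤ Nd := hn
    rw [hNd, Nat.le_floor_iff (by linarith)] at this
    exact_mod_cast this
  have hbase_u : ∀ i j : ℤ,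
      ‖((i : ℝ) • (triangularVec₁ 2 : EuclideanSpace ℝ (Fin 3)) + (j : ℝ) • triangularVec₂ 2) - c‖ ≤ Pu 0 → _ :=
    fun i j h => hbase i j (by rw [hPu0] at h; exact h)
  have hbase_d : ∀ i j : ℤ,
      ‖((i : ℝ) • (triangularVec₁ 2 : EuclideanSpace ℝ (Fin 3)) + (j : ℝ) • triangularVec₂ 2) - c‖ ≤ Pd 0 → _ :=
    fun i j h => hbase i j (by rw [hPd0] at h; exact h)
  -- the layers above
  obtain ⟨sp, sp0, hsp, hAup⟩ := layers_up hV' hc2 (fun y => dist y u' ≤ 13) (fun _ => False)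
    (fun y hy hg => hpat' y hy hg) (fun y hy hz => hz.elim) Nu Pu Ru
    (fun n hn => (hPu2 n (hn.trans hNu9)).1)
    (fun n hn => hRu n (by omega))
    (fun n hn => hparu n (by omega))
    (fun n hn y hy hy2 hyd => good_of y ((n : ℝ) + 1) (Pu (n + 1)) hy2 hyd
      ((Real.sqrt_nonneg 2).trans (hPu2 (n + 1) (by omega)).1)
      (hgoodu n (by omega) a (Pu (n + 1)) ha0 ha1 (hNu_le n hn) le_rfl
        ((Real.sqrt_nonneg 2).trans (hPu2 (n + 1) (by omega)).1)))
    (fun n hn => Or.inr (hfaru n (by omega)))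
    hs₀ hc_small hbase_u
  -- the layers below
  obtain ⟨sm, sm0, hsm, hAdn⟩ := layers_down hV' hc2 (fun y => dist y u' ≤ 13) (fun _ => False)
    (fun y hy hg => hpat' y hy hg) (fun y hy hz => hz.elim) Nd Pd Rd
    (fun n hn => (hPd2 n (hn.trans hNd5)).1)
    (fun n hn => hRd n (by omega))
    (fun n hn => hpard n (by omega))
    (fun n hn y hy hy2 hyd => by
      refine good_of y (-((n : ℝ) + 1)) (Pd (n + 1)) (by rw [hy2]; ring) ?_
        ((Real.sqrt_nonneg 2).trans (hPd2 (n + 1) (by omega)).1) ?_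
      · rw [neg_smul, ← sub_eq_add_neg]; exact hyd
      · have := hgoodd n (by omega) a (Pd (n + 1)) ha0 (hNd_le n hn) le_rfl
          ((Real.sqrt_nonneg 2).trans (hPd2 (n + 1) (by omega)).1)
        have e : (-((n : ℝ) + 1) - a) ^ 2 = ((n : ℝ) + 1 + a) ^ 2 := by ring
        rw [e]; exact this)
    (fun n hn => Or.inr (hfard n (by omega)))
    hs₀ hc_small hbase_d
  -- the Hägg sequence and the stacking points
  obtain ⟨sZ, hsZ, hLp, hLm, -, -⟩ := exists_haggSeq_of_signs sp sm hsp hsm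
  obtain ⟨memUp, memDn⟩ := barlowPos_mem_of_layers (V := V') hc2 Nu Nd Pu Ru Pd Rd
    (fun n hn => (Real.sqrt_nonneg 2).trans (hPu2 n (hn.trans hNu9)).1)
    (fun n hn => (Real.sqrt_nonneg 2).trans (hPd2 n (hn.trans hNd5)).1)
    (fun n hn => hRu n (hn.trans hNu9)) (fun n hn => hRd n (hn.trans hNd5))
    sZ sp sm hLp hLm hbase_u hAup hAdn
  -- no room: every stacking point of the `(7 + √22/3)`-ball about `u'` is a centre
  clear hAup hAdn hbase_u hbase_d hbase hgoodu hgoodd hparu hpard hfaru hfard hmin hpat hpat' good_of hc_small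
  refine exists_isometry_inter_closedBall_eq_of_frame_sharp hV q L u 7 hsZ (fun k i j hd => ?_)
  show barlowPos 2 layerSpacing sZ k i j ∈ V'
  obtain ⟨yh, hyh⟩ : ∃ yh : EuclideanSpace ℝ (Fin 3), yh = (i : ℝ) • (triangularVec₁ 2 : EuclideanSpace ℝ (Fin 3)) +
      (j : ℝ) • triangularVec₂ 2 + ((haggLabel sZ k : ℤ) : ℝ) • barlowOffset 2 := ⟨_, rfl⟩
  have hy : barlowPos 2 layerSpacing sZ k i j = yh + (k : ℝ) • layerNormal layerSpacing := by
    rw [hyh]; rfl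
  have hor : (yh - c) 2 = 0 := by rw [hyh]; simp [hc2]
  have hdist : ‖yh - c‖ ^ 2 + 8 / 3 * ((k : ℝ) - a) ^ 2 ≤ 73.34 := by
    have e : barlowPos 2 layerSpacing sZ k i j - u' = (yh - c) + ((k : ℝ) - a) • layerNormal layerSpacing := by
      rw [hy, hu'c]; module
    have h1 : dist (barlowPos 2 layerSpacing sZ k i j) u' ^ 2 ≤ 73.34 :=
      (pow_le_pow_left₀ dist_nonneg hd 2).trans seven_add_sqrt_sq_le
    rw [dist_eq_norm, e, norm_sq_add_smul_frameE hor] at h1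
    exact h1
  have hka : ((k : ℝ) - a) ^ 2 ≤ 5.2443 ^ 2 := by nlinarith [norm_nonneg (yh - c)]
  have hka' := abs_le_of_sq_le_sq' hka (by norm_num)
  rcases le_or_gt 0 k with hk | hk
  · -- layers `k ≥ 0`
    have ek : ((k.toNat : ℕ) : ℤ) = k := Int.toNat_of_nonneg hk
    have ekr : ((k.toNat : ℕ) : ℝ) = (k : ℝ) := by exact_mod_cast ek
    have hnNu : k.toNat ≤ Nu := by
      rw [hNu, Nat.le_floor_iff (by linarith only [ha0]), ekr]; linarith only [hka'.2]
    have h9 : k.toNat ≤ 9 := hnNu.trans hNu9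
    have hcov := hcovu k.toNat h9 a (‖yh - c‖ ^ 2) ha0 ha1 (by rw [ekr]; linarith only [hka'.2])
      (by rw [ekr]; exact hdist)
    have hR0 : 0 ≤ Ru k.toNat := ((Real.sqrt_nonneg 2).trans (hPu2 _ h9).1).trans (hPu2 _ h9).2
    have hle : ‖yh - c‖ ≤ Ru k.toNat := (pow_le_pow_iff_left₀ (norm_nonneg _) hR0 two_ne_zero).1 hcov
    have := memUp k.toNat hnNu i j (by rw [ek, ← hyh]; exact hle)
    rwa [ek] at this
  · -- layers `k < 0`
    have ek : (((-k).toNat : ℕ) : ℤ) = -k := Int.toNat_of_nonneg (by omega)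
    have ekr : (((-k).toNat : ℕ) : ℝ) = -(k : ℝ) := by exact_mod_cast ek
    have h1n : 1 ≤ (-k).toNat := by omega
    have hnNd : (-k).toNat ≤ Nd := by
      rw [hNd, Nat.le_floor_iff (by linarith only [ha1]), ekr]; linarith only [hka'.1]
    have h5 : (-k).toNat ≤ 5 := hnNd.trans hNd5
    have hcov := hcovd (-k).toNat h5 a (‖yh - c‖ ^ 2)
      (by rw [ekr]; have e : (-(k : ℝ) + a) ^ 2 = ((k : ℝ) - a) ^ 2 := by ring
          rw [e]; exact hdist)
    have hR0 : 0 ≤ Rd (-k).toNat := ((Real.sqrt_nonneg 2).trans (hPd2 _ h5).1).trans (hPd2 _ h5).2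
    have hle : ‖yh - c‖ ≤ Rd (-k).toNat := (pow_le_pow_iff_left₀ (norm_nonneg _) hR0 two_ne_zero).1 hcov
    have ek' : -(((-k).toNat : ℕ) : ℤ) = k := by rw [ek, neg_neg]
    have := memDn (-k).toNat h1n hnNd i j (by rw [ek', ← hyh]; exact hle)
    rwa [ek'] at this

/-- **Registered sub-goal `ballPropagation_caseA`** of the crux item (Case A, in closed form:
`caseA`). [cite: HalesDSP2012, §1.3] -/
theorem ballPropagation_caseA :
    ∀ (V : Set (EuclideanSpace ℝ (Fin 3))), Literature.Geometry.DiscreteGeometry.IsUnitBallPacking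
    V → ∀ (u q : EuclideanSpace ℝ (Fin 3)), q ∈ V → (∀ v ∈ V, dist u v ≤ 13 →
    Literature.Geometry.DiscreteGeometry.IsArrangedIn
    (Literature.Geometry.DiscreteGeometry.kissingShell V v)
    Literature.Geometry.DiscreteGeometry.fccKissingPattern ∨
    Literature.Geometry.DiscreteGeometry.IsArrangedIn
    (Literature.Geometry.DiscreteGeometry.kissingShell V v)
    Literature.Geometry.DiscreteGeometry.hcpKissingPattern) → dist u q ≤ 15 / 2 →
    Literature.Geometry.DiscreteGeometry.IsArrangedIn
    (Literature.Geometry.DiscreteGeometry.kissingShell V q)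
    Literature.Geometry.DiscreteGeometry.hcpKissingPattern → (∀ v ∈ V, dist u v ≤ 15 / 2 →
    Literature.Geometry.DiscreteGeometry.IsArrangedIn
    (Literature.Geometry.DiscreteGeometry.kissingShell V v)
    Literature.Geometry.DiscreteGeometry.hcpKissingPattern → dist u q ^ 2 - 1 / 3 ≤ dist u v ^ 2) →
    ∃ s : ℤ → ℤ, Literature.MathematicalPhysics.StatisticalMechanics.IsHaggSeq s ∧ ∃ g :
    EuclideanSpace ℝ (Fin 3) ≃ᵢ EuclideanSpace ℝ (Fin 3), V ∩ Metric.closedBall u 7 = g ''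
    Literature.MathematicalPhysics.StatisticalMechanics.barlowStacking 2 (2 * Real.sqrt (2 / 3)) s
    ∩ Metric.closedBall u 7 :=
  fun _ hV _ _ hq hpat hdq harr hmin => caseA hV hq hpat hdq harr hmin

end Summit.AtomisticToContinuum.Crystallization.Theorems

end
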